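/-
Copyright: the b2b-balaban T⁴-continuum CRUX team, row NE7b OWNER lineage `t4-ne7b-p1` (gen 146). Project licence.
-/
import Summits.QuantumFields.BalabanUV.T4Continuum.Spine.NE7b.SupWeightedClassRates

/-!
# THE RATE BOOKKEEPING OF THE WEIGHTED CLASS AT ORDER FIVE ((672) extended; SCOPING-d17 (R-d) / SCOPING (d18)).  The order-5 weighted slot
# letters (692)–(737), the interpolated pieces (678)∕(680)∕(683) and the entry majorant `M₅′` (687) take, beyond (672)'s order-4 algebra, the
# compatibilities `ϑ⁴ ≤ ϑ₂` (internal loads `≤ 4`), `ϑ⁶ ≤ σ(x,w)σ(y,w)` (crossing and `ρ` loads `≤ 6`), `ϑ ≤ r₁` (absorbed pairs), `r₁⁸ ≤ r`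
# (the full-graph decay of the tree and five-point terms, (679)∕(683)), and the geometry letters `Θ8 = sup Σ ϑ⁸∕ϑ₂`, `G = sup Σ ϑ⁶∕√ρ`,
# `S2 = sup Σ ϑ²∕r₁`.  THIS FILE is the EXPONENTIAL INSTANCE of the new algebraic hypotheses on a pseudometric space (`ϑ = e^{νd}`,
# `ϑ₂ = e^{ν₂d}`, `σ = e^{sd}`, `r₁ = e^{ζ₁d}`, `r = e^{ζd}`): they hold as soon as
#   `4ν ≤ ν₂`,  `6ν ≤ s`,  `ν ≤ ζ₁`,  `8ζ₁ ≤ ζ`;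
# the geometry letters are lattice sums of `e^{−(rate gap)d}`, finite iff `ν₂ > 8ν`, `η > 12ν` (`√ρ` at rate `η∕2`), `ζ₁ > 2ν` (plus dimension
# margins) — hypotheses of the slot files, not typed here.  READING (honest): with (526)'s `r²⁴ ≤ σσ` (`24ζ ≤ s`) the chain forces
# `s ≥ 24ζ ≥ 192ζ₁ > 384ν` and, by (659)'s transport, `ν₂ ≥ s`; since the input letters (weighted by `ϑ₂`) come from the previous output weight `ϑ`
# rescaled by `L` (`ν ↦ Lν`, (672) `expw_rescale`), THE ORDER-5 WEIGHTED CLASS ITERATES FOR BLOCKING FACTOR `L > 384` (order 4: `L > 64`), the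
# exponents `24` (526), `8` (683) and `2` (the `r₁`-star letter) being the cost drivers — convenience choices of the routing, not optimised
# (row NE7b, node U5c; (672) BY NAME; Mathlib; [folklore]).

Cell `pub-balaban`, sub-cell `t4`, spine estimate NE7b (`T4WeightBudget.RelWeightBound`; the cell's OWN estimate — NOT PRINTED in
[Bałaban 1983–89], NOT PROVED).  Crux-route work under `Spine/NE7b/` by the row OWNER (`t4-ne7b-p1` gen 146, file (746)) under FREEZE
(0)'s crux-prover clause; NOTHING of Bałaban's is named as a Lean object, valued or asserted; no `T4Continuum/Support` leaf typed; no
`def`, no notation; zero `sorry`.  Imports (BY NAME): the OWNER's (672) `…SupWeightedClassRates` ((476) `expw_triangle` through it).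

WHAT IS PROVED ([folklore]): **`expw_pow4_le`**, **`expw_pow6_le_cross`**, **`expw_le_r1`**, **`expw_r1_pow8_le`**, `expw_r1_submult`; toy (the
chain in numbers).

HONEST (what this is NOT).  Pointwise algebra of exponential weights; the lattice sums and the choice of `L` are not typed; scalar skeleton
((A3), NC-NE7b-α UNRULED); nothing of Bałaban's asserted.  BY-NAME EFFECT ON THE WALL: NONE.  NE7b NOT PRINTED ∕ NOT PROVED; spine PROVED 0∕9;
rung (B)+1 — the programme's measures remain FINITE-torus statements; NOT the mass gap, NOT Clay.  HONEST DEPENDENCY: continuum YM on T⁴ ⇐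
BetaPertH ∧ nine spine estimates (0∕9 proved); BetaPertH ⇐ (D1) ∧ (D4) ∧ CAP+tail; G-an2-4 gates asym, D1 and NE2∕3∕4.
-/

set_option autoImplicit false

noncomputable section

namespace Summit.QuantumFields.BalabanUV.T4Continuum.NE7b.SupWeightedClassRatesFive

open Real
open SupWeightedClassRates (expw_pow_le expw_pow_le_cross expw_submult)

variable {ι κ X : Type} [PseudoMetricSpace X] {p : ι → X} {q : κ → X} {ν ν₂ s ζ ζ₁ : ℝ}

/-- **Internal loads**: `4ν ≤ ν₂ ⟹ ϑ⁴ ≤ ϑ₂` (the order-5 weighted slot files' `hϑ4`). [folklore] -/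
theorem expw_pow4_le (h : 4 * ν ≤ ν₂) (x y : ι) : Real.exp (ν * dist (p x) (p y)) ^ 4 ≤ Real.exp (ν₂ * dist (p x) (p y)) :=
  expw_pow_le 4 (by exact_mod_cast h) x y

/-- **Crossing and `ρ` loads**: `0 ≤ ν`, `6ν ≤ s ⟹ ϑ(x,y)⁶ ≤ σ(x,w)σ(y,w)` (the slot files' `hϑσ6`). [folklore] -/
theorem expw_pow6_le_cross (hν : 0 ≤ ν) (h : 6 * ν ≤ s) (x y : ι) (w : κ) :
    Real.exp (ν * dist (p x) (p y)) ^ 6 ≤ Real.exp (s * dist (p x) (q w)) * Real.exp (s * dist (p y) (q w)) :=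
  expw_pow_le_cross 6 hν (by exact_mod_cast h) x y w

/-- **Absorbed pairs**: `ν ≤ ζ₁ ⟹ ϑ ≤ r₁` (the slot files' `hϑr₁`). [folklore] -/
theorem expw_le_r1 (h : ν ≤ ζ₁) (x y : ι) : Real.exp (ν * dist (p x) (p y)) ≤ Real.exp (ζ₁ * dist (p x) (p y)) :=
  Real.exp_le_exp.2 (mul_le_mul_of_nonneg_right h dist_nonneg)

/-- **The full-graph decay kernel against the tree weight**: `8ζ₁ ≤ ζ ⟹ r₁⁸ ≤ r` ((680)∕(683)∕(687)'s `hr₁8`). [folklore] -/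
theorem expw_r1_pow8_le (h : 8 * ζ₁ ≤ ζ) (x y : ι) : Real.exp (ζ₁ * dist (p x) (p y)) ^ 8 ≤ Real.exp (ζ * dist (p x) (p y)) :=
  expw_pow_le 8 (by exact_mod_cast h) x y

/-- `r₁` is submultiplicative (and `≥ 1`, symmetric, as every exponential weight: (672)). [folklore] -/
theorem expw_r1_submult (hζ : 0 ≤ ζ₁) (x y z : ι) :
    Real.exp (ζ₁ * dist (p x) (p z)) ≤ Real.exp (ζ₁ * dist (p x) (p y)) * Real.exp (ζ₁ * dist (p y) (p z)) :=
  expw_submult hζ x y z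

/-! ## Toy -/

/-- Toy (the order-5 rate chain in numbers): with `ν = 1`: `ζ₁ = 3 > 2`, `ζ = 24 ≥ 8ζ₁`, `s = 576 ≥ 24ζ` and `≥ 6ν`, `ν₂ = 576 ≥ s`, `≥ 4ν`, `> 8ν`,
and a blocking factor `L = 576 ≥ ν₂` closes the chain (any `L > 384` admits such a choice after rescaling the margins). -/
example : (2 : ℝ) < 3 ∧ (8 : ℝ) * 3 ≤ 24 ∧ (24 : ℝ) * 24 ≤ 576 ∧ (6 : ℝ) * 1 ≤ 576 ∧ (4 : ℝ) * 1 ≤ 576 ∧ (8 : ℝ) * 1 < 576 := by norm_num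

end Summit.QuantumFields.BalabanUV.T4Continuum.NE7b.SupWeightedClassRatesFive

end
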